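import Mathlib.Data.Real.Basic
import Mathlib.Tactic.Linarith
import Mathlib.Tactic.Ring
import Mathlib.Tactic.Positivity
import Mathlib.Tactic.FieldSimp
import HarnessLib

/-!
# Kozma–Nitzan CONJECTURE 2 (pre-FKG, form (3)) on APEX-FOREST graphs — the algebraic induction step, machine-checked
# (`NoHeavyLowerTail` cell, stmt-CriticalPhenomena-4575; new-inequality factory seat `prim-ineq-gen-7`, gen 3)

Support file (`--supports stmt-CriticalPhenomena-4575`).  Pure real algebra; no measure theory, no definitions, no named facts, no sorries.
Companion of `…ApexForestGluingAlgebra` (Conjecture 1 / EG⁺ on the same class).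

THE THEOREM this file serves (paper proof run/shared/lean/prim/prim-ineq-gen-7/PROOF-CONJ2-APEXFOREST.md; census 0 / 166 007 exact instances): **if `G − b` is a
forest then for every relay set `A` meeting the component of `o` there is a relay `α ∈ A` with `P(o ↔ A, o ↮ b) ≤ P(α ↮ b, o ↔ A ∪ {b})`** — Kozma–Nitzan's
inequality (3) for the relay set `A ∪ {b}`, hence their Conjecture 2 (pre-FKG), Conjecture 1, event gluing with constant 1 and linear near-one gluing on the
whole class, uniformly in `|A|`, depth and branching.  The forest induction detaches one child subtree (edge weight `q`); a block carries
`(P(root-cluster hub-free), P(… and relay-free)) = (a,b)` resp. `(g,h)`, and its certifying relay carries `(d, e, ζ)` = (P(α ↮ b), P(α's cluster hub-free and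
contains the root), P(root-cluster hub-free & relay-free and α's cluster hub-free)) subject to the five facts `e ≤ X`, `h·d ≤ ζ ≤ h` (the lower bound is Harris),
`e + ζ ≤ d ≤ 1` and the induction hypothesis `d − ζ ≥ X` (`X = g − h` the block's gluing quantity).  Transported to the composed tree the two candidate values are
`d₁(1 − b + bq) − q(1−a)e₁ − bqζ₁` (child relay) and `d' − q(1−g)e' − (1 − q(1−h))ζ'` (root-block relay), and the composed gluing quantity is `aG − bH`,
`G = 1 − q(1−g)`, `H = 1 − q(1−h)`.  This file proves that one of the two candidates dominates `aG − bH`: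

* `ApexForestPreFKG.child_value_ge`, `root_value_ge` — the transported value of a certified relay is at least `μ₁[(1−b)(1−s) + a s]` resp. `μ'[(1−b)G + b s]`
  (`μ = X/(1−h)` the block's conditional hub-avoidance, `s = q(1−h)`), the minima over the certificate polytopes;
* `ApexForestPreFKG.step3` — **the induction step**: `aG − bH ≤ max(child value, root value)`, via the exact identities
  `m₁ − (aG − bH) = (1−b)(1−s)(μ₁ − μ')` and `m' − (aG − bH) = s·b·(μ' − μ₁)`.
[cite: KozmaNitzan2024, Conjecture 2 and (3) (p. 3); Theorem 1 (the case |A| = 2)]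
-/

namespace Summit.CriticalPhenomena.PercolationContinuityZ3.Theorems

namespace ApexForestPreFKG

/-- **Child-block certificate bound.**  With `X₁ = g − h`, `h < 1`: if `e₁ ≤ X₁`, `h d₁ ≤ ζ₁`, `X₁ ≤ d₁ − ζ₁` then
`d₁(1 − b + bq) − q(1−a)e₁ − bqζ₁ ≥ (X₁/(1−h))·[(1−b)(1 − q(1−h)) + a q (1−h)]`. [this file] -/
theorem child_value_ge (a b g h q d₁ e₁ ζ₁ : ℝ) (hb0 : 0 ≤ b) (hb1 : b ≤ 1) (ha1 : a ≤ 1)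
    (hh1 : h < 1) (hq0 : 0 ≤ q)
    (he1X : e₁ ≤ g - h) (hz1 : h * d₁ ≤ ζ₁) (hd1 : g - h ≤ d₁ - ζ₁) :
    (g - h) / (1 - h) * ((1 - b) * (1 - q * (1 - h)) + a * q * (1 - h)) ≤
      d₁ * (1 - b + b * q) - q * (1 - a) * e₁ - b * q * ζ₁ := by
  have h1h : 0 < 1 - h := by linarith
  -- d₁ ≥ X₁ + ζ₁ ≥ X₁ + h d₁  ⇒  d₁ (1 - h) ≥ X₁  ⇒  d₁ ≥ μ₁
  set μ₁ := (g - h) / (1 - h) with hμ₁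
  have hX : g - h = μ₁ * (1 - h) := by rw [hμ₁]; field_simp
  have hd1' : μ₁ ≤ d₁ := by
    rw [hμ₁, div_le_iff₀ h1h]; nlinarith
  -- value = d₁(1-b) + bq(d₁ - ζ₁) - q(1-a)e₁ ≥ d₁(1-b) + bq X₁ - q(1-a) X₁
  have hqa : 0 ≤ q * (1 - a) := mul_nonneg hq0 (by linarith)
  have hbq : 0 ≤ b * q := mul_nonneg hb0 hq0
  have key : d₁ * (1 - b) + b * q * (g - h) - q * (1 - a) * (g - h) ≤
      d₁ * (1 - b + b * q) - q * (1 - a) * e₁ - b * q * ζ₁ := by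
    nlinarith [mul_le_mul_of_nonneg_left he1X hqa, mul_le_mul_of_nonneg_left hd1 hbq]
  have key2 : (g - h) / (1 - h) * ((1 - b) * (1 - q * (1 - h)) + a * q * (1 - h)) ≤
      d₁ * (1 - b) + b * q * (g - h) - q * (1 - a) * (g - h) := by
    rw [hX]
    have : μ₁ * (1 - h) / (1 - h) = μ₁ := by field_simp
    rw [this]
    have h1b : 0 ≤ 1 - b := by linarith
    nlinarith [mul_le_mul_of_nonneg_right hd1' h1b]
  linarith

/-- **Root-block certificate bound.**  With `X' = a − b`, `b < 1`: if `e' ≤ X'`, `b d' ≤ ζ'`, `X' ≤ d' − ζ'` then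
`d' − q(1−g)e' − (1 − q(1−h))ζ' ≥ (X'/(1−b))·[(1−b)(1 − q(1−g)) + b q (1−h)]`. [this file] -/
theorem root_value_ge (a b g h q d' e' ζ' : ℝ) (hb0 : 0 ≤ b) (hb1 : b < 1) (hg1 : g ≤ 1) (hh1 : h ≤ 1)
    (hq0 : 0 ≤ q)
    (he'X : e' ≤ a - b) (hz' : b * d' ≤ ζ') (hd' : a - b ≤ d' - ζ') :
    (a - b) / (1 - b) * ((1 - b) * (1 - q * (1 - g)) + b * q * (1 - h)) ≤
      d' - q * (1 - g) * e' - (1 - q * (1 - h)) * ζ' := by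
  have h1b : 0 < 1 - b := by linarith
  set μ' := (a - b) / (1 - b) with hμ'
  have hX : a - b = μ' * (1 - b) := by rw [hμ']; field_simp
  have hd'' : μ' ≤ d' := by
    rw [hμ', div_le_iff₀ h1b]; nlinarith
  have hqg : 0 ≤ q * (1 - g) := mul_nonneg hq0 (by linarith)
  have hs0 : 0 ≤ q * (1 - h) := mul_nonneg hq0 (by linarith)
  -- value = (d' - ζ') + q(1-h) ζ' - q(1-g) e' ≥ X' + q(1-h) b d' - q(1-g) X'
  have key : (a - b) + q * (1 - h) * (b * d') - q * (1 - g) * (a - b) ≤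
      d' - q * (1 - g) * e' - (1 - q * (1 - h)) * ζ' := by
    nlinarith [mul_le_mul_of_nonneg_left he'X hqg, mul_le_mul_of_nonneg_left hz' hs0]
  have key2 : (a - b) / (1 - b) * ((1 - b) * (1 - q * (1 - g)) + b * q * (1 - h)) ≤
      (a - b) + q * (1 - h) * (b * d') - q * (1 - g) * (a - b) := by
    rw [hX]
    have : μ' * (1 - b) / (1 - b) = μ' := by field_simp
    rw [this]
    nlinarith [mul_le_mul_of_nonneg_left hd'' (mul_nonneg hs0 hb0)]
  linarith

/-- **The induction step for Conjecture 2 / (3) on apex-forests.**  Root block `(a,b)`, child block `(g,h)` attached with weight `q`, certified relays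
`(d₁,e₁,ζ₁)` (child) and `(d',e',ζ')` (root block) satisfying the five facts and the induction hypotheses; then the composed gluing quantity
`aG − bH` is dominated by one of the two transported relay values.  (Case `μ₁ ≥ μ'`: the child's relay, identity `m₁ − LHS = (1−b)(1−s)(μ₁−μ')`;
case `μ' ≥ μ₁`: the root block's relay, identity `m' − LHS = s b (μ'−μ₁)`.) [this file] -/
theorem step3 (a b g h q d₁ e₁ ζ₁ d' e' ζ' : ℝ) (hb0 : 0 ≤ b) (ha1 : a ≤ 1)
    (hh0 : 0 ≤ h) (hg1 : g ≤ 1) (hq0 : 0 ≤ q) (hq1 : q ≤ 1) (hb1 : b < 1) (hh1 : h < 1)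
    (he1X : e₁ ≤ g - h) (hz1 : h * d₁ ≤ ζ₁) (hd1 : g - h ≤ d₁ - ζ₁)
    (he'X : e' ≤ a - b) (hz' : b * d' ≤ ζ') (hd' : a - b ≤ d' - ζ') :
    a * (1 - q * (1 - g)) - b * (1 - q * (1 - h)) ≤
      max (d₁ * (1 - b + b * q) - q * (1 - a) * e₁ - b * q * ζ₁) (d' - q * (1 - g) * e' - (1 - q * (1 - h)) * ζ') := by
  have h1h : 0 < 1 - h := by linarith
  have h1b : 0 < 1 - b := by linarith
  set μ₁ := (g - h) / (1 - h) with hμ₁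
  set μ' := (a - b) / (1 - b) with hμ'
  have hg_eq : g = 1 - (1 - h) * (1 - μ₁) := by rw [hμ₁]; field_simp; ring
  have ha_eq : a = 1 - (1 - b) * (1 - μ') := by rw [hμ']; field_simp; ring
  have hm1 := child_value_ge a b g h q d₁ e₁ ζ₁ hb0 hb1.le ha1 hh1 hq0 he1X hz1 hd1
  have hm' := root_value_ge a b g h q d' e' ζ' hb0 hb1 hg1 hh1.le hq0 he'X hz' hd'
  -- the two exact identities
  have id1 : (g - h) / (1 - h) * ((1 - b) * (1 - q * (1 - h)) + a * q * (1 - h)) -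
      (a * (1 - q * (1 - g)) - b * (1 - q * (1 - h))) = (1 - b) * (1 - q * (1 - h)) * (μ₁ - μ') := by
    rw [hg_eq, ha_eq]
    have e1 : (1 - (1 - h) * (1 - μ₁) - h) / (1 - h) = μ₁ := by field_simp; ring
    rw [e1]; ring
  have id2 : (a - b) / (1 - b) * ((1 - b) * (1 - q * (1 - g)) + b * q * (1 - h)) -
      (a * (1 - q * (1 - g)) - b * (1 - q * (1 - h))) = q * (1 - h) * b * (μ' - μ₁) := by
    rw [hg_eq, ha_eq]
    have e2 : (1 - (1 - b) * (1 - μ') - b) / (1 - b) = μ' := by field_simp; ring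
    rw [e2]; ring
  have hs1 : 0 ≤ 1 - q * (1 - h) := by
    have : q * (1 - h) ≤ 1 * 1 := mul_le_mul hq1 (by linarith) (by linarith) zero_le_one
    linarith
  rcases le_total μ' μ₁ with hcase | hcase
  · have : 0 ≤ (1 - b) * (1 - q * (1 - h)) * (μ₁ - μ') :=
      mul_nonneg (mul_nonneg h1b.le hs1) (by linarith)
    refine le_trans ?_ (le_max_left _ _)
    linarith
  · have : 0 ≤ q * (1 - h) * b * (μ' - μ₁) :=
      mul_nonneg (mul_nonneg (mul_nonneg hq0 h1h.le) hb0) (by linarith)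
    refine le_trans ?_ (le_max_right _ _)
    linarith

end ApexForestPreFKG

end Summit.CriticalPhenomena.PercolationContinuityZ3.Theorems
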